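import Summits.HodgeConjecture.HodgeConjecture.Theorems.H413WeilFinRepMirror
import Summits.HodgeConjecture.CorCM.B01.Transposition.Item6CentralTypeAtPinConj
import HarnessLib

/-!
# FLOOR-0 P4, stub S5 (`stub_T3b_conjugatePartnerAt`), piece (J-b): THE MIRROR OF `ι_μ` AT `⟨a⟩` IS `ι_{μ'}` AT `⟨−a⟩`, `μ'` OF WEIGHT ONE
# WITH THE CONJUGATE CM TYPE `Φ̄_μ` — the splitting identification behind `ω_V(t') ≅ \overline{ω_V(t)}`

Cell hodgecm-mathlib, crux item H413 = stmt-HodgeConjecture-24833, P4 line `Cruxes/H413/Lines/F0_P4AdmissibleOccursInH1.lean`, stub S5.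
Sequel of ★ `Theorems/H413WeilFinRepMirror` (p792056: the mirror splitting `s̄` of a compatible pair splitting `s` is compatible and continuous;
its Weil operators are the complex conjugates of those of `s`).  Here, in the package currency `HodgeCM.Model.LiuIndex.SplittingAt V a` of a
rank-3 CM hermitian space `V` and a Gram scalar `a` (the currency of ★ `Transposition/Item6CentralTypeAtPin[Conj]`):

* §1 the data of the MIRROR SCALAR `a'` (`a'.1 = −a.1`): `vec a' = −vec a`, `diag (vec a') = −diag (vec a)`, `realDiagonal (vec a') = −realDiagonal (vec a)`.
* §2 **`centralType_mirror`** — THE CENTRAL-TYPE FLIP: `centralType (vec a') (weightOneType Φ̄) = −centralType (vec a) (weightOneType Φ)` for EVERY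
  CM type `Φ` (the Konno–Konno weight `n(τ_w+1)/2 − q_v` of ★ `Def411WeilCarriersCentralTypeGaussian.centralType`, read through ★
  `Weil1964.central_line_weightOneType'`: negating the line swaps the sign count `q ↦ n − q`, conjugating the type swaps `τ ↦ −τ`).
* §3 the mirror splitting READ AT THE SCALAR `a'` (`splittingCongr` of ★ `HodgeCM.WeilCoinv.mirrorSplitting s` along §1): compatible
  (`isCompatAtScalar_mirror`), continuous, and its centre acts on the thin-coset Gaussian test functions as the `C`-conjugate of `s`'s
  (`pairRep_mirror_center`, the `hconj` binder of ★ `hasCentralTypeAt_neg_of_conj_of_val_eq_neg`, from ★ `pairRep_mirrorSplitting`).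
* §4 **`exists_weightOne_eq_chiSplittingLine_mirror`** — for a continuous compatible `s` at `a` of central type `centralType (vec a) (weightOneType Φ)`,
  its mirror at `a'` IS `ι_{toHecke μ'}` for some `μ'` conjugate symplectic OF WEIGHT ONE with `HasCMType μ' Φ̄` (★ pin-3
  `exists_weightOne_eq_chiSplittingLine_toHeckeCharacter_of_hasCentralTypeAt_weightOneType` at `a'`); and **`…_mirror_chiSplittingLine`** — the
  instance `s = ι_{toHecke μ}`, `μ` of weight one with `HasCMType μ Φ` (★ `hasCentralTypeAt_chiSplittingLine_toHeckeCharacter_weightOneType`):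
  «the complex conjugate of the oscillator representation attached to `(μ, a)` is the one attached to `(μ', −a)`, `Φ_{μ'} = Φ̄_μ`»
  ([Liu2021, App. D Lem. D.1 (2)] with Rem. 4.4: `μᶜ` has the conjugate CM type) — at the level of the pair splittings; no sign hypothesis on `a`.

THEOREMS ONLY (no definition, no named fact, no instance, no `sorry`).  NOT here: the junction of the pin's `(TW a, JW a)` line data with the
scalar currency, the line character, the re-pointing `⟨−a⟩ ↦ ⟨r ε'⟩`, the triple `t'`.  HC_CM is proved only modulo the printed citations until rung 0
closes; this file proves nothing about them.

References: [Liu2021] Y. Liu, Camb. J. Math. 9 (2021), Def. 4.11–4.12, Rem. 4.2, Rem. 4.4, App. D Lem. D.1 (2), Lem. D.2; [KonnoKonno2007]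
Kyushu J. Math. 61 (2007), §3.1, Lemma 5.2 p. 73; [GelbartRogawski1991] Invent. Math. 105 (1991), §3.1 Prop. 3.1.1 p. 455, Remark p. 457;
[Li1992] J. reine angew. Math. 428 (1992), p. 181; [Kudla1994] Israel J. Math. 87 (1994), §2.
-/

set_option autoImplicit false
set_option linter.dupNamespace false

noncomputable section

namespace Summit.HodgeConjecture.HodgeConjecture.Cruxes.H413.MirrorAtScalar

open NumberField NumberField.InfinitePlace NumberField.ComplexEmbedding NumberField.mixedEmbedding IsDedekindDomain
open scoped Matrix SchwartzMap Classical TensorProduct ComplexConjugate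
open Literature.NumberTheory.Automorphic Literature.NumberTheory.Automorphic.UnitaryGroup Literature.NumberTheory.Weil1964
open Literature.NumberTheory.GelbartRogawski1991 Literature.NumberTheory.GelbartRogawski1991.UnitaryDualPair
open Literature.NumberTheory.GelbartRogawski1991.GRConstruction
open Literature.NumberTheory.Automorphic.Liu2021.Def411WeilCarriersDoubling
open Literature.NumberTheory.Automorphic.IdeleClassGroup
open Literature.NumberTheory.GaloisRepresentations
open Literature.NumberTheory.ComplexMultiplication.CMTypeOps (bar mem_bar_iff)
open Literature.RepresentationTheory.HarrisKudlaSweet1996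
open Literature.Analysis.SegalBargmann
open HodgeCM HodgeCM.Model HodgeCM.Model.LiuIndex
open HodgeCM.Model.ArchSideTerm (e₁)
open HodgeCM.Model.SupplyInstance (testFun finEmb coe_testFun)
open Summit.HodgeConjecture.CorCM.Transposition.CentralTypeAtPin
open Summit.HodgeConjecture.HodgeConjecture.Cruxes.H413.WeilFinRepMirror
open HodgeCM.WeilCoinv (mirrorSplitting)

variable {L : CMField} {ι₁ : (L : Type) →+* ℂ} (V : HermSpace3 L ι₁)

/-! ## §1 The data of the mirror scalar -/

section Data

variable {L : CMField} {a a' : RealScalar L} (ha' : a'.1 = -a.1)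
include ha'

/-- `vec a' = −vec a` for the mirror scalar `a' = −a`. [cite: Kudla1994, §2] -/
theorem vec_eq_neg : RealScalar.vec a' = -RealScalar.vec a := funext fun _ => ha'

/-- `diag (vec a') = −diag (vec a)`. [cite: Kudla1994, §2] -/
theorem diagonal_vec_eq_neg : Matrix.diagonal (RealScalar.vec a') = -Matrix.diagonal (RealScalar.vec a) := by
  rw [vec_eq_neg ha', Matrix.diagonal_neg]
  rfl

/-- `realDiagonal (vec a') = −realDiagonal (vec a)` over `L⁺`. [cite: Kudla1994, §2] -/
theorem realDiagonal_vec_eq_neg :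
    realDiagonal (L : Type) (RealScalar.vec a') (RealScalar.vec_real a') = -realDiagonal (L : Type) (RealScalar.vec a) (RealScalar.vec_real a) := by
  rw [realDiagonal, realDiagonal, Matrix.diagonal_neg]
  refine congrArg Matrix.diagonal (funext fun i => Subtype.ext ?_)
  rw [NegMemClass.coe_neg]
  change RealScalar.vec a' i = -RealScalar.vec a i
  rw [vec_eq_neg ha', Pi.neg_apply]

end Data

/-! ## §2 The central-type flip -/

section CentralType

omit V in
/-- the weight-one type of the conjugate CM type is the negative: `weightOneType Φ̄ = −weightOneType Φ`. [cite: Liu2021, Remark 4.2 and Remark 4.4] -/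
theorem weightOneType_bar (Φ : Literature.AlgebraicGeometry.Motives.CMType (L : Type)) (w : InfinitePlace (L : Type)) :
    weightOneType (L : Type) (bar Φ) w = -weightOneType (L : Type) Φ w := by
  unfold weightOneType
  by_cases h : w.embedding ∈ Φ.1
  · rw [if_pos h, if_neg (fun h' => (mem_bar_iff Φ _).1 h' h), neg_neg]
  · rw [if_neg h, if_pos ((mem_bar_iff Φ _).2 h)]

/-- **THE CENTRAL-TYPE FLIP**: `centralType (vec a') (weightOneType Φ̄) = −centralType (vec a) (weightOneType Φ)` at every infinite place — negating
the line swaps the negative sign count `q_v ↦ n − q_v` of `V ⊗ ⟨a⟩`, conjugating the CM type swaps the weight-one type `τ ↦ −τ`, and Konno–Konno's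
weight `n(τ_w+1)/2 − q_v` changes sign (read through ★ `central_line_weightOneType'`, whose case condition is the SAME for `(a, Φ)` and `(−a, Φ̄)`).
[cite: KonnoKonno2007, Lemma 5.2 p. 73] [cite: Liu2021, Remark 4.2, App. D Lem. D.2] -/
theorem centralType_mirror {a a' : RealScalar L} (ha' : a'.1 = -a.1) (Φ : Literature.AlgebraicGeometry.Motives.CMType (L : Type))
    (w : InfinitePlace (L : Type)) :
    centralType (L : Type) e₁ (frameD V) (frameD_real V) (RealScalar.vec a') (RealScalar.vec_real a') (weightOneType (L : Type) (bar Φ)) w =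
      -centralType (L : Type) e₁ (frameD V) (frameD_real V) (RealScalar.vec a) (RealScalar.vec_real a) (weightOneType (L : Type) Φ) w := by
  set v := realPlaceUnder (L : Type) w with hv
  have hw : (cmPlaceOver (L : Type) v).1 = w := (realPlaceEquiv (L : Type)).apply_symm_apply w
  unfold centralType negCount
  rw [← hv]
  rw [show w = (cmPlaceOver (L : Type) v).1 from hw.symm]
  rw [central_line_weightOneType' (L : Type) e₁ (frameD V) (frameD_real V) (RealScalar.vec a') (RealScalar.vec_real a') (frameD_ne V)
      (RealScalar.vec_ne a' 0) (bar Φ) v,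
    central_line_weightOneType' (L : Type) e₁ (frameD V) (frameD_real V) (RealScalar.vec a) (RealScalar.vec_real a) (frameD_ne V)
      (RealScalar.vec_ne a 0) Φ v,
    weightOneType_bar]
  -- the case conditions agree: `w.emb ∈ Φ̄ ↔ 0 < σ(−a)·im` is `w.emb ∉ Φ ↔ ¬ 0 < σ(a)·im`
  have hre : ((cmPlaceOver (L : Type) v).1.embedding (RealScalar.vec a' 0)).re = -((cmPlaceOver (L : Type) v).1.embedding (RealScalar.vec a 0)).re := by
    rw [RealScalar.vec_zero, RealScalar.vec_zero, ha', map_neg, Complex.neg_re]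
  have hne : ((cmPlaceOver (L : Type) v).1.embedding (RealScalar.vec a 0)).re * ((cmPlaceOver (L : Type) v).1.embedding (imagUnit (L : Type))).im ≠ 0 :=
    mul_ne_zero (re_embedding_cmPlaceOver_ne_zero (L : Type) v (RealScalar.vec a) (RealScalar.vec_real a) (RealScalar.vec_ne a 0))
      (im_embedding_cmPlaceOver_imagUnit_ne_zero (L : Type) v)
  have hiff : ((cmPlaceOver (L : Type) v).1.embedding ∈ (bar Φ).1 ↔
        0 < ((cmPlaceOver (L : Type) v).1.embedding (RealScalar.vec a' 0)).re * ((cmPlaceOver (L : Type) v).1.embedding (imagUnit (L : Type))).im) ↔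
      ((cmPlaceOver (L : Type) v).1.embedding ∈ Φ.1 ↔
        0 < ((cmPlaceOver (L : Type) v).1.embedding (RealScalar.vec a 0)).re * ((cmPlaceOver (L : Type) v).1.embedding (imagUnit (L : Type))).im) := by
    have hlt : ((cmPlaceOver (L : Type) v).1.embedding (RealScalar.vec a 0)).re * ((cmPlaceOver (L : Type) v).1.embedding (imagUnit (L : Type))).im < 0 ↔
        ¬0 < ((cmPlaceOver (L : Type) v).1.embedding (RealScalar.vec a 0)).re * ((cmPlaceOver (L : Type) v).1.embedding (imagUnit (L : Type))).im :=
      ⟨fun h h' => lt_asymm h h', fun h => lt_of_le_of_ne (not_lt.1 h) hne⟩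
    rw [hre, neg_mul, mem_bar_iff, neg_pos, hlt, not_iff_not]
  by_cases hc : ((cmPlaceOver (L : Type) v).1.embedding ∈ Φ.1 ↔
      0 < ((cmPlaceOver (L : Type) v).1.embedding (RealScalar.vec a 0)).re * ((cmPlaceOver (L : Type) v).1.embedding (imagUnit (L : Type))).im)
  · rw [if_pos hc, if_pos (hiff.2 hc), neg_mul]
  · rw [if_neg hc, if_neg (fun h => hc (hiff.1 h)), neg_mul]

end CentralType

/-! ## §3 The mirror splitting read at the mirror scalar -/

section Mirror

variable {a a' : RealScalar L} (ha' : a'.1 = -a.1) (s : SplittingAt V a)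

/-- **the mirror of `s` at the scalar `a'` is COMPATIBLE** ([GelbartRogawski1991, Prop. 3.1.1] shape) when `s` is: ★ `isCompatible_mirrorSplitting`
transported along `diag (vec a') = −diag (vec a)`. [cite: GelbartRogawski1991, §3.1 Prop. 3.1.1 p. 455 L1–3; Remark p. 457 L4] -/
theorem isCompatAtScalar_mirror (hs : IsCompatAtScalar V a s) :
    IsCompatAtScalar V a'
      (splittingCongr (↥(maximalRealSubfield (L : Type))) (L : Type) (IsCMField.complexConj (L : Type)) 3 1 e₁ (Matrix.diagonal (frameD V))
        (realDiagonal_vec_eq_neg ha').symm (diagonal_vec_eq_neg ha').symm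
        (mirrorSplitting (↥(maximalRealSubfield (L : Type))) (L : Type) (IsCMField.complexConj (L : Type)) 3 1 e₁ (Matrix.diagonal (frameD V))
          (Matrix.diagonal (RealScalar.vec a)) s)) :=
  isCompatible_splittingCongr (↥(maximalRealSubfield (L : Type))) (L : Type) (IsCMField.complexConj (L : Type)) 3 1 e₁ (Matrix.diagonal (frameD V))
    (complexConj_imagUnit (L : Type)) (imagUnit_ne_zero (L : Type)) (imagUnit_mul_self (L : Type))
    (realDiagonal_isSymm (L : Type) (frameD V) (frameD_real V)) (isUnit_det_realDiagonal (L : Type) (frameD V) (frameD_real V) (frameD_ne V))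
    (realDiagonal_map (L : Type) (frameD V) (frameD_real V)).symm (realDiagonal_vec_eq_neg ha').symm (diagonal_vec_eq_neg ha').symm
    (isSymm_neg (realDiagonal_isSymm (L : Type) (RealScalar.vec a) (RealScalar.vec_real a)))
    (realDiagonal_isSymm (L : Type) (RealScalar.vec a') (RealScalar.vec_real a'))
    (isUnit_det_neg' (isUnit_det_realDiagonal (L : Type) (RealScalar.vec a) (RealScalar.vec_real a) (RealScalar.vec_ne a)))
    (isUnit_det_realDiagonal (L : Type) (RealScalar.vec a') (RealScalar.vec_real a') (RealScalar.vec_ne a'))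
    (neg_eq_map_neg (realDiagonal_map (L : Type) (RealScalar.vec a) (RealScalar.vec_real a)).symm)
    (realDiagonal_map (L : Type) (RealScalar.vec a') (RealScalar.vec_real a')).symm
    (isCompatible_mirrorSplitting (↥(maximalRealSubfield (L : Type))) (L : Type) (IsCMField.complexConj (L : Type)) 3 1 e₁
      (Matrix.diagonal (frameD V)) (Matrix.diagonal (RealScalar.vec a)) (complexConj_imagUnit (L : Type)) (imagUnit_ne_zero (L : Type))
      (imagUnit_mul_self (L : Type)) (realDiagonal_isSymm (L : Type) (frameD V) (frameD_real V))
      (realDiagonal_isSymm (L : Type) (RealScalar.vec a) (RealScalar.vec_real a))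
      (isUnit_det_realDiagonal (L : Type) (frameD V) (frameD_real V) (frameD_ne V))
      (isUnit_det_realDiagonal (L : Type) (RealScalar.vec a) (RealScalar.vec_real a) (RealScalar.vec_ne a))
      (realDiagonal_map (L : Type) (frameD V) (frameD_real V)).symm (realDiagonal_map (L : Type) (RealScalar.vec a) (RealScalar.vec_real a)).symm hs)

/-- the mirror of a continuous `s` at `a'` is continuous. [cite: GelbartRogawski1991, §3.1 Prop. 3.1.1 p. 455 L1–3] -/
theorem continuous_mirror (hsc : Continuous s) :
    Continuous
      (splittingCongr (↥(maximalRealSubfield (L : Type))) (L : Type) (IsCMField.complexConj (L : Type)) 3 1 e₁ (Matrix.diagonal (frameD V))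
        (realDiagonal_vec_eq_neg ha').symm (diagonal_vec_eq_neg ha').symm
        (mirrorSplitting (↥(maximalRealSubfield (L : Type))) (L : Type) (IsCMField.complexConj (L : Type)) 3 1 e₁ (Matrix.diagonal (frameD V))
          (Matrix.diagonal (RealScalar.vec a)) s)) :=
  continuous_splittingCongr (↥(maximalRealSubfield (L : Type))) (L : Type) (IsCMField.complexConj (L : Type)) 3 1 e₁ (Matrix.diagonal (frameD V))
    _ _ (continuous_mirrorSplitting (↥(maximalRealSubfield (L : Type))) (L : Type) (IsCMField.complexConj (L : Type)) 3 1 e₁ (Matrix.diagonal (frameD V))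
      (Matrix.diagonal (RealScalar.vec a)) hsc)

/-- the operator law read at the scalar `a'`: for `W`-elements `u`, `u'` with the same matrix (in `U(diag (vec a))(𝔸)`, `U(diag (vec a'))(𝔸)`),
`ω(s̄'_pair(g, u')) Ψ = C (ω(s_pair(g, u)) (C Ψ))` (★ `omega_pairSplitting_mirrorSplitting` + ★ `omega_splittingCongr_apply`). [cite: Li1992, p. 181] -/
theorem pairRep_mirror_apply (g : adelic (↥(maximalRealSubfield (L : Type))) (L : Type) (IsCMField.complexConj (L : Type)) 3 (Matrix.diagonal (frameD V)))
    (u : adelic (↥(maximalRealSubfield (L : Type))) (L : Type) (IsCMField.complexConj (L : Type)) 1 (Matrix.diagonal (RealScalar.vec a)))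
    (u' : adelic (↥(maximalRealSubfield (L : Type))) (L : Type) (IsCMField.complexConj (L : Type)) 1 (Matrix.diagonal (RealScalar.vec a')))
    (hu : ((u' : GL (Fin 1) (AdeleRing (𝓞 (L : Type)) (L : Type))) : Matrix (Fin 1) (Fin 1) (AdeleRing (𝓞 (L : Type)) (L : Type))) =
      (u : GL (Fin 1) (AdeleRing (𝓞 (L : Type)) (L : Type))))
    (Ψ : piSchwartzBruhat (↥(maximalRealSubfield (L : Type))) (Fin 3)) :
    pairRep (↥(maximalRealSubfield (L : Type))) (L : Type) (IsCMField.complexConj (L : Type)) 3 1 e₁ (Matrix.diagonal (frameD V))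
        (Matrix.diagonal (RealScalar.vec a'))
        (splittingCongr (↥(maximalRealSubfield (L : Type))) (L : Type) (IsCMField.complexConj (L : Type)) 3 1 e₁ (Matrix.diagonal (frameD V))
          (realDiagonal_vec_eq_neg ha').symm (diagonal_vec_eq_neg ha').symm
          (mirrorSplitting (↥(maximalRealSubfield (L : Type))) (L : Type) (IsCMField.complexConj (L : Type)) 3 1 e₁ (Matrix.diagonal (frameD V))
            (Matrix.diagonal (RealScalar.vec a)) s)) (g, u') Ψ =
      piSchwartzBruhatConj (↥(maximalRealSubfield (L : Type))) (Fin 3)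
        (pairRep (↥(maximalRealSubfield (L : Type))) (L : Type) (IsCMField.complexConj (L : Type)) 3 1 e₁ (Matrix.diagonal (frameD V))
          (Matrix.diagonal (RealScalar.vec a)) s (g, u) (piSchwartzBruhatConj (↥(maximalRealSubfield (L : Type))) (Fin 3) Ψ)) := by
  -- generalise the cast equations so that `subst` eliminates the `splittingCongr`
  suffices key : ∀ {TW' : Matrix (Fin 1) (Fin 1) ↥(maximalRealSubfield (L : Type))} {JW' : Matrix (Fin 1) (Fin 1) (L : Type)}
      (hT : -realDiagonal (L : Type) (RealScalar.vec a) (RealScalar.vec_real a) = TW') (hJ : -Matrix.diagonal (RealScalar.vec a) = JW')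
      (u'' : adelic (↥(maximalRealSubfield (L : Type))) (L : Type) (IsCMField.complexConj (L : Type)) 1 JW')
      (hu'' : ((u'' : GL (Fin 1) (AdeleRing (𝓞 (L : Type)) (L : Type))) : Matrix (Fin 1) (Fin 1) (AdeleRing (𝓞 (L : Type)) (L : Type))) =
        (u : GL (Fin 1) (AdeleRing (𝓞 (L : Type)) (L : Type)))),
      pairRep (↥(maximalRealSubfield (L : Type))) (L : Type) (IsCMField.complexConj (L : Type)) 3 1 e₁ (Matrix.diagonal (frameD V)) JW'
          (splittingCongr (↥(maximalRealSubfield (L : Type))) (L : Type) (IsCMField.complexConj (L : Type)) 3 1 e₁ (Matrix.diagonal (frameD V)) hT hJ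
            (mirrorSplitting (↥(maximalRealSubfield (L : Type))) (L : Type) (IsCMField.complexConj (L : Type)) 3 1 e₁ (Matrix.diagonal (frameD V))
              (Matrix.diagonal (RealScalar.vec a)) s)) (g, u'') Ψ =
        piSchwartzBruhatConj (↥(maximalRealSubfield (L : Type))) (Fin 3)
          (pairRep (↥(maximalRealSubfield (L : Type))) (L : Type) (IsCMField.complexConj (L : Type)) 3 1 e₁ (Matrix.diagonal (frameD V))
            (Matrix.diagonal (RealScalar.vec a)) s (g, u) (piSchwartzBruhatConj (↥(maximalRealSubfield (L : Type))) (Fin 3) Ψ)) from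
    key _ _ u' hu
  intro TW' JW' hT hJ u'' hu''
  subst hT hJ
  rw [splittingCongr_rfl]
  exact pairRep_mirrorSplitting (↥(maximalRealSubfield (L : Type))) (L : Type) (IsCMField.complexConj (L : Type)) 3 1 e₁ (Matrix.diagonal (frameD V))
    (Matrix.diagonal (RealScalar.vec a)) g u u'' hu'' Ψ

/-- **the `hconj` binder of ★ `hasCentralTypeAt_neg_of_conj_of_val_eq_neg` for the mirror**: on the thin-coset Gaussian test functions of the
mirror line the centre `(t · 1_V, 1)` acts through `ω_ψ ∘ s̄'` as the `C`-conjugate of its action through `ω_ψ ∘ s`. [cite: Li1992, p. 181]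
[cite: Liu2021, App. D Lemma D.1 (2) (l. 5231)] -/
theorem pairRep_mirror_center
    (t : ↥(Literature.NumberTheory.Automorphic.relNormOneInfUnits (↥(maximalRealSubfield (L : Type))) (L : Type)))
    (x₀ : Fin 3 → ↥(maximalRealSubfield (L : Type))) (N : ℕ) :
    pairRep (↥(maximalRealSubfield (L : Type))) (L : Type) (IsCMField.complexConj (L : Type)) 3 1 e₁ (Matrix.diagonal (frameD V))
        (Matrix.diagonal (RealScalar.vec a'))
        (splittingCongr (↥(maximalRealSubfield (L : Type))) (L : Type) (IsCMField.complexConj (L : Type)) 3 1 e₁ (Matrix.diagonal (frameD V))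
          (realDiagonal_vec_eq_neg ha').symm (diagonal_vec_eq_neg ha').symm
          (mirrorSplitting (↥(maximalRealSubfield (L : Type))) (L : Type) (IsCMField.complexConj (L : Type)) 3 1 e₁ (Matrix.diagonal (frameD V))
            (Matrix.diagonal (RealScalar.vec a)) s))
        (CMCenter (L : Type) (frameD V)
          ((cmAdelicOneEquivRelNormOne (L : Type)).symm
            (Literature.NumberTheory.Automorphic.relNormOneInfToIdeles (↥(maximalRealSubfield (L : Type))) (L : Type) t)), 1)
        (testFun (↥(maximalRealSubfield (L : Type))) (Fin 3) (gaussianAt V a') x₀ N) =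
      piSchwartzBruhatConj (↥(maximalRealSubfield (L : Type))) (Fin 3)
        (pairRep (↥(maximalRealSubfield (L : Type))) (L : Type) (IsCMField.complexConj (L : Type)) 3 1 e₁ (Matrix.diagonal (frameD V))
          (Matrix.diagonal (RealScalar.vec a)) s
          (CMCenter (L : Type) (frameD V)
            ((cmAdelicOneEquivRelNormOne (L : Type)).symm
              (Literature.NumberTheory.Automorphic.relNormOneInfToIdeles (↥(maximalRealSubfield (L : Type))) (L : Type) t)), 1)
          (piSchwartzBruhatConj (↥(maximalRealSubfield (L : Type))) (Fin 3)
            (testFun (↥(maximalRealSubfield (L : Type))) (Fin 3) (gaussianAt V a') x₀ N))) :=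
  pairRep_mirror_apply V ha' s _ 1 1 (by rw [OneMemClass.coe_one, OneMemClass.coe_one]) _

end Mirror

/-! ## §4 The identification: the mirror of `ι_μ` is `ι_{μ'}`, `μ'` of weight one with the conjugate CM type -/

section Identification

variable {a a' : RealScalar L} (ha' : a'.1 = -a.1)

set_option maxHeartbeats 4000000 in
/-- **THE MIRROR OF A SPLITTING OF WEIGHT-ONE CENTRAL TYPE IS `ι_{μ'}`, `μ'` OF WEIGHT ONE WITH THE CONJUGATE CM TYPE.**  For a continuous compatible
pair splitting `s` at the scalar `a` whose central type is `centralType (vec a) (weightOneType Φ)` (e.g. `s = ι_{toHecke μ}`, `μ` of weight one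
with `Φ_μ = Φ`), the mirror splitting at `a' = −a` IS `ι_{toHecke μ'}` for some `μ'` conjugate symplectic OF WEIGHT ONE with `HasCMType μ' Φ̄`:
the flip ★ `hasCentralTypeAt_neg_of_conj_of_val_eq_neg` (`hconj` = §3), the central-type flip §2, and ★ pin-3
`exists_weightOne_eq_chiSplittingLine_toHeckeCharacter_of_hasCentralTypeAt_weightOneType` at `a'`.
[cite: Liu2021, App. D Lemma D.1 (2) (l. 5231), Remark 4.4, Definition 4.12] [cite: GelbartRogawski1991, §3.1 Prop. 3.1.1 p. 455, Remark p. 457 L4–13]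
[cite: KonnoKonno2007, Lemma 5.2 p. 73] -/
theorem exists_weightOne_eq_chiSplittingLine_mirror (Φ : Literature.AlgebraicGeometry.Motives.CMType (L : Type))
    (s : SplittingAt V a) (hsc : Continuous s) (hs : IsCompatAtScalar V a s)
    (hP : HasCentralTypeAt V a s
      (centralType (L : Type) e₁ (frameD V) (frameD_real V) (RealScalar.vec a) (RealScalar.vec_real a) (weightOneType (L : Type) Φ))) :
    ∃ (μ' : Literature.NumberTheory.Automorphic.IdeleClassGroup (L : Type) →ₜ* Circle) (hμ' : IsConjugateSymplectic (L : Type) μ'),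
      HasWeight (L : Type) μ' 1 ∧ HasCMType (L : Type) μ' (bar Φ) ∧
        splittingCongr (↥(maximalRealSubfield (L : Type))) (L : Type) (IsCMField.complexConj (L : Type)) 3 1 e₁ (Matrix.diagonal (frameD V))
            (realDiagonal_vec_eq_neg ha').symm (diagonal_vec_eq_neg ha').symm
            (mirrorSplitting (↥(maximalRealSubfield (L : Type))) (L : Type) (IsCMField.complexConj (L : Type)) 3 1 e₁ (Matrix.diagonal (frameD V))
              (Matrix.diagonal (RealScalar.vec a)) s) =
          chiSplittingLine (L : Type) e₁ (frameD V) (frameD_real V) (frameD_ne V) (toHeckeCharacter (L : Type) μ')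
            (isUnitary_toHeckeCharacter (L : Type) μ') (isSplittingChar_toHeckeCharacter_of_isConjugateSymplectic (L : Type) μ' hμ')
            (realDiagonal (L : Type) (RealScalar.vec a') (RealScalar.vec_real a'))
            (isUnit_det_realDiagonal (L : Type) (RealScalar.vec a') (RealScalar.vec_real a') (RealScalar.vec_ne a'))
            (Matrix.diagonal (RealScalar.vec a')) (realDiagonal_map (L : Type) (RealScalar.vec a') (RealScalar.vec_real a')).symm := by
  have hflip := hasCentralTypeAt_neg_of_conj_of_val_eq_neg V ha' (pairRep_mirror_center V ha' s) hP
  have hct : -centralType (L : Type) e₁ (frameD V) (frameD_real V) (RealScalar.vec a) (RealScalar.vec_real a) (weightOneType (L : Type) Φ) =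
      centralType (L : Type) e₁ (frameD V) (frameD_real V) (RealScalar.vec a') (RealScalar.vec_real a') (weightOneType (L : Type) (bar Φ)) :=
    funext fun w => by rw [Pi.neg_apply, centralType_mirror V ha' Φ w]
  rw [hct] at hflip
  exact exists_weightOne_eq_chiSplittingLine_toHeckeCharacter_of_hasCentralTypeAt_weightOneType V a' (bar Φ) _
    (continuous_mirror V ha' s hsc) (isCompatAtScalar_mirror V ha' s hs) hflip

set_option maxHeartbeats 4000000 in
/-- **THE MIRROR OF `ι_μ` AT `⟨a⟩` IS `ι_{μ'}` AT `⟨−a⟩`, `μ'` OF WEIGHT ONE WITH `Φ_{μ'} = Φ̄_μ`** — for EVERY `μ` conjugate symplectic of weight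
one with CM type `Φ` and every Gram scalar `a` (no sign hypothesis on `a`): the instance `s = ι_{toHecke μ}` of the previous theorem (its central
type is ★ `hasCentralTypeAt_chiSplittingLine_toHeckeCharacter_weightOneType`; `ι_μ` is continuous and compatible, ★ `continuous_chiSplittingLine` ∕
`isCompatible_chiSplittingLine`).  This is the splitting-level content of [Liu2021, App. D Lem. D.1 (2)] «`\overline{ω(μ,ε,χ)} ≅ ω(μᶜ, −ε, χ⁻¹)`»
(with Rem. 4.4: `Φ_{μᶜ} = Φ̄_μ`), in the form the existential S5 needs (SOME `μ'` of the conjugate type).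
[cite: Liu2021, App. D Lemma D.1 (2) (l. 5231), Remark 4.4, Definition 4.12] [cite: GelbartRogawski1991, §3.1 Prop. 3.1.1 p. 455, Remark p. 457 L4–13] -/
theorem exists_weightOne_eq_chiSplittingLine_mirror_chiSplittingLine
    (μ : Literature.NumberTheory.Automorphic.IdeleClassGroup (L : Type) →ₜ* Circle) (hμ : IsConjugateSymplectic (L : Type) μ)
    (hw : HasWeight (L : Type) μ 1) {Φ : Literature.AlgebraicGeometry.Motives.CMType (L : Type)} (hΦμ : HasCMType (L : Type) μ Φ) :
    ∃ (μ' : Literature.NumberTheory.Automorphic.IdeleClassGroup (L : Type) →ₜ* Circle) (hμ' : IsConjugateSymplectic (L : Type) μ'),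
      HasWeight (L : Type) μ' 1 ∧ HasCMType (L : Type) μ' (bar Φ) ∧
        splittingCongr (↥(maximalRealSubfield (L : Type))) (L : Type) (IsCMField.complexConj (L : Type)) 3 1 e₁ (Matrix.diagonal (frameD V))
            (realDiagonal_vec_eq_neg ha').symm (diagonal_vec_eq_neg ha').symm
            (mirrorSplitting (↥(maximalRealSubfield (L : Type))) (L : Type) (IsCMField.complexConj (L : Type)) 3 1 e₁ (Matrix.diagonal (frameD V))
              (Matrix.diagonal (RealScalar.vec a))
              (chiSplittingLine (L : Type) e₁ (frameD V) (frameD_real V) (frameD_ne V) (toHeckeCharacter (L : Type) μ)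
                (isUnitary_toHeckeCharacter (L : Type) μ) (isSplittingChar_toHeckeCharacter_of_isConjugateSymplectic (L : Type) μ hμ)
                (realDiagonal (L : Type) (RealScalar.vec a) (RealScalar.vec_real a))
                (isUnit_det_realDiagonal (L : Type) (RealScalar.vec a) (RealScalar.vec_real a) (RealScalar.vec_ne a))
                (Matrix.diagonal (RealScalar.vec a)) (realDiagonal_map (L : Type) (RealScalar.vec a) (RealScalar.vec_real a)).symm)) =
          chiSplittingLine (L : Type) e₁ (frameD V) (frameD_real V) (frameD_ne V) (toHeckeCharacter (L : Type) μ')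
            (isUnitary_toHeckeCharacter (L : Type) μ') (isSplittingChar_toHeckeCharacter_of_isConjugateSymplectic (L : Type) μ' hμ')
            (realDiagonal (L : Type) (RealScalar.vec a') (RealScalar.vec_real a'))
            (isUnit_det_realDiagonal (L : Type) (RealScalar.vec a') (RealScalar.vec_real a') (RealScalar.vec_ne a'))
            (Matrix.diagonal (RealScalar.vec a')) (realDiagonal_map (L : Type) (RealScalar.vec a') (RealScalar.vec_real a')).symm :=
  exists_weightOne_eq_chiSplittingLine_mirror V ha' Φ _
    (continuous_chiSplittingLine (L : Type) e₁ (frameD V) (frameD_real V) (frameD_ne V) _ _ _ _ _ _ _)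
    (isCompatible_chiSplittingLine (L : Type) e₁ (frameD V) (frameD_real V) (frameD_ne V) _ _ _ _
      (realDiagonal_isSymm (L : Type) (RealScalar.vec a) (RealScalar.vec_real a)) _ _ _)
    (hasCentralTypeAt_chiSplittingLine_toHeckeCharacter_weightOneType V a μ hμ hw hΦμ)

end Identification

end Summit.HodgeConjecture.HodgeConjecture.Cruxes.H413.MirrorAtScalar

end
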